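import Literature.NumberTheory.EllipticCurves.KummerSelmerStructure
import Literature.NumberTheory.EllipticCurves.SelmerImage
import Literature.NumberTheory.EllipticCurves.Rank1Residual.Typed.X5DescentSelmer
import Mathlib.GroupTheory.OrderOfElement
import HarnessLib

/-!
# The rank-one inputs of the count (C) in Kummer form: `ord κ_m(P) = p^m` and
# `p^e · Sel^{(p^m)}(E/K) ⊆ ℤ κ_m(P)` from "`P` generates `E(K)/p^m`" and "`Ш(E/K)[p^m] ⊆ Ш[p^e]`"
# (cell `b2b-bsdres`, CLASS-CLOSURE lane, class O10 — x1b GEN 37, class lead; file 66 of the series: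
# inputs (ii) and (iii) of file 63 `DefectCountFiniteLevel.relIndex_mul_prime_pow_eq_card_mul_prod`)

HONEST FRAMING (cell `b2b-bsdres`, run/shared/lean/b2b/bsd-rank1-residual/, verbatim in every
file): the goal of the cell is to DELETE the COMBINATION-SHAPED residual classes of the
Birch–Swinnerton-Dyer formula for ALL analytic-rank `≤ 1` elliptic curves over `ℚ` — "full BSD
formula for every rank `≤ 1` curve in class `C`" assembled STRICTLY from published theorems — so
that the rank-`≤ 1` remainder becomes exactly the CONSTRUCTION-SHAPED classes, which are TYPED
(missing-input `Prop`s), NOT attempted. This is not "finishing BSD". CLASS-CLOSURE lane: prove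
what is provable now; shrink each hard class to its core with data; no claim beyond stated classes;
research routes on CONSTRUCTION-SHAPED X12 / O10; census / instrument output = EVIDENCE / conjecture
items, NEVER a Literature fact; `RESIDUAL-MAP.md` marks change only by signed lines. THIS FILE:
TOOL THEOREMS ONLY — no definition, no named Literature fact, no Summits-side fact `def … : Prop`,
no `sorry`, axioms standard; the Mordell–Weil input ("`P` generates `E(K)/p^m E(K)` and has order `p^m`
there") and the `Ш`-input ("`Ш(E/K)[p^m] ⊆ Ш(E/K)[p^e]`", finiteness of `Ш[p^∞]` in exponent form)
are HYPOTHESES; nothing is booked; no label / mark / count / sub-cell moves; (C1_η), (C2_η-GZ),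
(C3_η) stay typed as filed (cc-typer-6's pen); O10 stays OPEN / CONSTRUCTION-SHAPED; nothing about
`BSD(W, p)` of any pair is claimed.

## What

For `E = W` elliptic over a number field `K`, `n ≠ 0`, the Kummer map
`κ = kummerMapTorsion W n hdiv : E(K) →+ H¹(K, E[n])` (Literature `KummerMap.lean`, kernel `nE(K)`,
image `Sel^{(n)} ∩ ker(H¹(K, E[n]) → H¹(K, E))`):

* `kummerMapTorsion_mem_selmerGroup_kummerSelmerStructure` — `κ(P) ∈ H¹_𝓚(K, E[n])` (Literature
  `kummerMapTorsion_mem_selmerGroup`);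
* **`addOrderOf_kummerMapTorsion_eq`** — if `a • P ∈ p^m E(K) ⟹ p^m ∣ a` then
  **`ord κ_{p^m}(P) = p^m`** (input (ii), global half: `g = κ_m(P)` of order `p^m`);
* **`pow_nsmul_mem_zmultiples_kummerMapTorsion`** — if every `Q ∈ E(K)` is `a • P` modulo
  `p^m E(K)` and `Ш(E/K)[p^m] ⊆ Ш(E/K)[p^e]`, then **`p^e · s ∈ ℤ κ_{p^m}(P)` for every
  `s ∈ Sel^{(p^m)}(E/K)`** (input (iii): `s ↦ Ш` is killed by `p^e`, so `p^e s` is a Kummer class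
  `κ(Q) = a κ(P)`) — both in the `kummerSelmerStructure` currency of files 61–63 as well
  (`…_selmerStructure`).

NOT here: the LOCAL half of (ii) (`ord loc_p κ_m(P) = p^{m−ν}`, the definition of `ν`); that the
`p*`-twist `W` of (C3_η) satisfies the two hypotheses (rank one, `E(ℚ)[p] = 0`, `Ш[p^∞]` finite —
Gross–Zagier–Kolyvagin; successor / typer).

References: [SilvermanAEC2009] VIII.§2, X.§4 (Thm. X.4.2); [MilneADT2006] I §6 (6.14);
[GreenbergLNM1716] §4 (pp. 98–103).
-/

noncomputable section

open scoped Classical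

universe u

open WeierstrassCurve Literature.NumberTheory.EllipticCurves Literature.NumberTheory.GaloisRepresentations
open NumberField IsDedekindDomain

namespace Summit.BirchSwinnertonDyer.Rank1Residual.Additive.RankOneKummerInputs

variable {K : Type u} [Field K] [NumberField K] (W : WeierstrassCurve K)

/-- `κ(P) ∈ H¹_𝓚(K, E[n])` (Literature `WeierstrassCurve.kummerMapTorsion_mem_selmerGroup`, in the
`kummerSelmerStructure` currency).
[cite: SilvermanAEC2009, X.§4 diagram (**)] -/
theorem kummerMapTorsion_mem_selmerGroup_kummerSelmerStructure (n : ℤ)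
    (hdiv : ∀ P : geomPoints W, ∃ Q : geomPoints W, n • Q = P) (P : W.toAffine.Point) :
    kummerMapTorsion W n hdiv P ∈ (W.kummerSelmerStructure n).selmerGroup := by
  rw [← selmerGroup_eq_selmerGroup_kummerSelmerStructure]
  exact WeierstrassCurve.kummerMapTorsion_mem_selmerGroup W n hdiv P

/-- **`ord κ_{p^m}(P) = p^m`** when `P` has order exactly `p^m` in `E(K)/p^m E(K)` (hypothesis `hP`:
`a • P ∈ p^m E(K) ⟹ p^m ∣ a`; e.g. `E(K) = ℤP ⊕ T` with `p ∤ #T`), `m ≥ 1`: the kernel of the Kummer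
map is `p^m E(K)` (Literature `kummerMapTorsion_ker`).  Input (ii), global half, of file 63.
[cite: SilvermanAEC2009, §VIII.2 (Kummer sequence)] -/
theorem addOrderOf_kummerMapTorsion_eq {p : ℕ} [hp : Fact p.Prime] {m : ℕ} (hm : 1 ≤ m)
    (hdiv : ∀ P : geomPoints W, ∃ Q : geomPoints W, ((p ^ m : ℕ) : ℤ) • Q = P)
    (P : W.toAffine.Point)
    (hP : ∀ a : ℤ, a • P ∈ (zsmulAddGroupHom ((p ^ m : ℕ) : ℤ) : W.toAffine.Point →+ _).range →
      ((p ^ m : ℕ) : ℤ) ∣ a) :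
    addOrderOf (kummerMapTorsion W ((p ^ m : ℕ) : ℤ) hdiv P) = p ^ m := by
  obtain ⟨m', rfl⟩ : ∃ m', m = m' + 1 := ⟨m - 1, by omega⟩
  have hker := kummerMapTorsion_ker W ((p ^ (m' + 1) : ℕ) : ℤ) hdiv
  refine addOrderOf_eq_prime_pow (fun h => ?_) ?_
  · -- `p^{m'} • κ(P) = κ(p^{m'} • P) = 0` would put `p^{m'} • P` in `p^{m'+1} E(K)`
    have hmem : ((p ^ m' : ℕ) : ℤ) • P ∈ (kummerMapTorsion W ((p ^ (m' + 1) : ℕ) : ℤ) hdiv).ker := by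
      rw [AddMonoidHom.mem_ker, map_zsmul, natCast_zsmul, h]
    rw [hker] at hmem
    have hdvd := hP _ hmem
    have h1 : (p ^ (m' + 1) : ℕ) ∣ p ^ m' := by exact_mod_cast hdvd
    have h2 : p ^ (m' + 1) ≤ p ^ m' := Nat.le_of_dvd (pow_pos hp.out.pos _) h1
    have h3 : p ^ m' < p ^ (m' + 1) := Nat.pow_lt_pow_right hp.out.one_lt (Nat.lt_succ_self m')
    omega
  · have hmem : ((p ^ (m' + 1) : ℕ) : ℤ) • P ∈
        (kummerMapTorsion W ((p ^ (m' + 1) : ℕ) : ℤ) hdiv).ker := by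
      rw [hker]; exact ⟨P, rfl⟩
    rw [AddMonoidHom.mem_ker, map_zsmul, natCast_zsmul] at hmem
    exact hmem

/-- **`p^e · Sel^{(n)}(E/K) ⊆ ℤ κ_n(P)`** (`n = p^m`, or any `n`): if `P` generates `E(K)/nE(K)`
(`hgen`: every `Q` is `a • P` modulo `nE(K)`) and `Ш(E/K)[n] ⊆ Ш(E/K)[p^e]` (`hSha`, the exponent of
`Ш[p^∞]`), then for every Selmer class `s`, `p^e • s` dies in `H¹(K, E)` (its image lies in
`Ш ∩ H¹(K,E)[n]`), hence is a Kummer class `κ(Q)` (Literature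
`mem_range_kummerMapTorsion_of_torsionH1ToH1_eq_zero`), `= a • κ(P)`.  Input (iii) of file 63.
[cite: SilvermanAEC2009, Thm X.4.2(a)] [cite: MilneADT2006, I §6, (6.14)] -/
theorem pow_nsmul_mem_zmultiples_kummerMapTorsion {n : ℤ}
    (hdiv : ∀ P : geomPoints W, ∃ Q : geomPoints W, n • Q = P) (P : W.toAffine.Point)
    (hgen : ∀ Q : W.toAffine.Point, ∃ a : ℤ,
      Q - a • P ∈ (zsmulAddGroupHom n : W.toAffine.Point →+ _).range)
    {p e : ℕ} (hSha : ∀ c ∈ W.sha, n • c = 0 → p ^ e • c = 0)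
    {s : galH1Torsion W n} (hs : s ∈ selmerGroup W n) :
    p ^ e • s ∈ AddSubgroup.zmultiples (kummerMapTorsion W n hdiv P) := by
  -- the image of `s` in `H¹(K, E)` lies in `Ш[n]`, hence is killed by `p^e`
  have hsha : torsionH1ToH1 W n s ∈ W.sha := by
    rw [selmerGroup_eq_comap_sha] at hs; exact hs
  have htor : n • torsionH1ToH1 W n s = 0 := torsionH1ToH1_mem_torsionBy W n s
  have h0 : torsionH1ToH1 W n (p ^ e • s) = 0 := by
    rw [map_nsmul]; exact hSha _ hsha htor
  -- so `p^e • s` is a Kummer class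
  obtain ⟨Q, hQ⟩ := mem_range_kummerMapTorsion_of_torsionH1ToH1_eq_zero W n hdiv _ h0
  obtain ⟨a, R, hR⟩ := hgen Q
  have hQ' : Q = a • P + zsmulAddGroupHom n R := by rw [hR]; abel
  have hkerR : kummerMapTorsion W n hdiv (zsmulAddGroupHom n R) = 0 := by
    have : zsmulAddGroupHom n R ∈ (kummerMapTorsion W n hdiv).ker := by
      rw [kummerMapTorsion_ker]; exact ⟨R, rfl⟩
    exact this
  rw [← hQ, hQ', map_add, hkerR, add_zero, map_zsmul]
  exact AddSubgroup.zsmul_mem _ (AddSubgroup.mem_zmultiples _) a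

/-- The same in the `kummerSelmerStructure` currency of files 61–63.
[cite: SilvermanAEC2009, Thm X.4.2(a)] -/
theorem pow_nsmul_mem_zmultiples_kummerMapTorsion_selmerStructure {n : ℤ}
    (hdiv : ∀ P : geomPoints W, ∃ Q : geomPoints W, n • Q = P) (P : W.toAffine.Point)
    (hgen : ∀ Q : W.toAffine.Point, ∃ a : ℤ,
      Q - a • P ∈ (zsmulAddGroupHom n : W.toAffine.Point →+ _).range)
    {p e : ℕ} (hSha : ∀ c ∈ W.sha, n • c = 0 → p ^ e • c = 0)
    {s : galoisCohomology (W.torsionGaloisModule n) 1}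
    (hs : s ∈ (W.kummerSelmerStructure n).selmerGroup) :
    p ^ e • s ∈ AddSubgroup.zmultiples (kummerMapTorsion W n hdiv P) := by
  rw [← selmerGroup_eq_selmerGroup_kummerSelmerStructure] at hs
  exact pow_nsmul_mem_zmultiples_kummerMapTorsion W hdiv P hgen hSha hs

end Summit.BirchSwinnertonDyer.Rank1Residual.Additive.RankOneKummerInputs

end
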